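import Literature.NumberTheory.LFunctions.FeketePolyaKernelSignTables
import HarnessLib

/-!
# Fekete–Pólya certificates of every order, walked blockwise on packed digits (engine v4)

Topic `Literature/NumberTheory/LFunctions`; namespace `Literature.NumberTheory.LFunctions.FeketePolyaKernel`
(sequel of `FeketePolyaKernelSignTables.lean`). Small computable definitions and THEOREMS (no named fact,
no `sorry`): the certificate `blockCert b e K Q (Tp, Tm)` that the iterated partial sums `S_K(n)` of the value
stream of the sign tables `(Tp, Tm)` (`Q` slots, `S_0 = value`, `S_{k+1}(n) = Σ_{1 ≤ m ≤ n} S_k(m)`) are `≥ 0`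
for `0 ≤ n ≤ Q` and `S_j(Q) ≥ 0` for `1 ≤ j ≤ K` — Montgomery–Vaughan §11.2.1 Exercise 7 (f) over one period —
processed in BLOCKS (binary splitting of the period, depth `e`, blocks of `≈ Q/2^e` positions): the state `[S_1, …, S_K]` before the block and, per order, ONE packed
vector of the `L` values over the block (plus part and minus part separately, digits in base `2^b`): the next
order is `S·𝟙 + prefix sums` = one multiplication by the all-ones vector (`kpack_mul_onesV_low`), the outgoing
state is the last digit, and `S_K ≥ 0` over the block is ONE comparison: after adding the half-digit offset
`2^{b−1}·𝟙` and subtracting the minus part, every top bit must be set (`blockOK`). A digit bound `D_K` is carried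
along and tested (`D_K < 2^{b−1}`), which is what makes the digit arithmetic carry-free; the parameters `b`
(digit width) and `e` (splitting depth) are free. Soundness: `blockCert_sound` (abstract value stream),
`lfunction_ne_zero_of_blockCert` (the engine: `L(σ, χ) ≠ 0` on `σ > 0` for `χ ≠ χ₀` quadratic, through
`FeketePolya1912_holds` for `χ↑(q·w)`, one period suffices `FeketePolyaTable.ipsum_nonneg_of_period`, and the
positive Euler factors of the descent `χ↑(q·w) → χ`). Measured: `≈ 0.6–3 s` of kernel time per conductor at
`q ≈ 2·10⁴` (all orders `≤ 12`, induced moduli `≤ 10⁵`), against `10–130 s` for the per-position walks of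
`FeketePolyaKernelCertificates{HigherOrder,ResidueWrappers}.lean`.

## References

* H. L. Montgomery, R. C. Vaughan, *Multiplicative Number Theory I*, CUP 2007, §11.2.1 Exercises 7–8. [MontgomeryVaughan2007]
* M. Fekete, G. Pólya, *Über ein Problem von Laguerre*, Rend. Circ. Mat. Palermo 34 (1912) 89–120. [FeketePolya1912]
* J. von zur Gathen, J. Gerhard, *Modern Computer Algebra*, 3rd ed., CUP 2013, §8.4. [GathenGerhard2013ModernComputerAlgebra]
-/

namespace Literature.NumberTheory.LFunctions

namespace FeketePolyaKernel

open Finset Literature.Analysis.Convolution FeketePolyaTable Literature.Barriers.RiemannHypothesis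
open scoped NumberTheorySymbols

/-! ### Iterated sums of a value stream -/

/-- `itS x k n = S_k(n)`: `S_0 = x`, `S_{k+1}(n) = Σ_{m=1}^{n} S_k(m)`. [cite: MontgomeryVaughan2007, §11.2.1 Exercise 7 (c)] -/
def itS (x : ℕ → ℤ) : ℕ → ℕ → ℤ
  | 0, n => x n
  | k + 1, n => ∑ m ∈ Icc 1 n, itS x k m

/-- `S_{k+1}(0) = 0`. [cite: MontgomeryVaughan2007, §11.2.1 Exercise 7 (c)] -/
theorem itS_succ_zero (x : ℕ → ℤ) (k : ℕ) : itS x (k + 1) 0 = 0 := by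
  simp [itS]

/-- `S_{k+1}(n+1) = S_{k+1}(n) + S_k(n+1)`. [cite: MontgomeryVaughan2007, §11.2.1 Exercise 7 (c)] -/
theorem itS_succ_succ (x : ℕ → ℤ) (k n : ℕ) : itS x (k + 1) (n + 1) = itS x (k + 1) n + itS x k (n + 1) := by
  simp only [itS]
  rw [Finset.sum_Icc_succ_top (by omega)]

/-- `S_k(0) = 0` when `x 0 = 0`. [cite: MontgomeryVaughan2007, §11.2.1 Exercise 7 (c)] -/
theorem itS_zero {x : ℕ → ℤ} (hx0 : x 0 = 0) : ∀ k, itS x k 0 = 0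
  | 0 => hx0
  | k + 1 => itS_succ_zero x k

/-- **Block formula**: `S_{k+1}(pos + j) = S_{k+1}(pos − 1) + Σ_{i ≤ j} S_k(pos + i)` (with `x 0 = 0`, so that at
`pos = 0` the junk value `S_{k+1}(0 − 1) = S_{k+1}(0) = 0` is the right one). [cite: MontgomeryVaughan2007, §11.2.1 Exercise 7 (c)] -/
theorem itS_block {x : ℕ → ℤ} (hx0 : x 0 = 0) (k pos : ℕ) :
    ∀ j, itS x (k + 1) (pos + j) = itS x (k + 1) (pos - 1) + ∑ i ∈ range (j + 1), itS x k (pos + i)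
  | 0 => by
    rw [Finset.sum_range_one, add_zero]
    cases pos with
    | zero => simp [itS_zero hx0]
    | succ p => rw [Nat.add_sub_cancel]; exact itS_succ_succ x k p
  | j + 1 => by
    rw [← add_assoc, itS_succ_succ, itS_block hx0 k pos j, Finset.sum_range_succ _ (j + 1), add_assoc,
      add_assoc pos j 1]

/-! ### State lists -/

/-- `stList f k₀ K' = [f (k₀+1), …, f (k₀+K')]`. [cite: MontgomeryVaughan2007, §11.2.1 Exercise 7 (f)] -/
def stList (f : ℕ → ℤ) : ℕ → ℕ → List ℤ
  | _, 0 => []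
  | k₀, K' + 1 => f (k₀ + 1) :: stList f (k₀ + 1) K'

/-- A state list of constant entries. [folklore] -/
private theorem stList_const {f : ℕ → ℤ} {c : ℤ} : ∀ (k₀ K' : ℕ), (∀ k, k₀ < k → k ≤ k₀ + K' → f k = c) →
    stList f k₀ K' = List.replicate K' c
  | _, 0, _ => rfl
  | k₀, K' + 1, h => by
    rw [stList, List.replicate_succ, h (k₀ + 1) (by omega) (by omega),
      stList_const (k₀ + 1) K' fun k hk hk' => h k (by omega) (by omega)]

/-- Membership in a state list. [folklore] -/
private theorem mem_stList (f : ℕ → ℤ) : ∀ (k₀ K' k : ℕ), k₀ < k → k ≤ k₀ + K' → f k ∈ stList f k₀ K'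
  | _, 0, k, h1, h2 => by omega
  | k₀, K' + 1, k, h1, h2 => by
    rw [stList, List.mem_cons]
    rcases Nat.eq_or_lt_of_le h1 with h | h
    · exact Or.inl (by rw [show k = k₀ + 1 by omega])
    · exact Or.inr (mem_stList f (k₀ + 1) K' k h (by omega))

/-- `stepAcc` advances a state list by one position: from `[F_k(n−1)]_k` and `F_{k₀}(n)` to `[F_k(n)]_k` when
`F_{k+1}(n) = F_{k+1}(n−1) + F_k(n)`. [folklore] -/
private theorem stepAcc_stList (F : ℕ → ℕ → ℤ) (n : ℕ) (hF : ∀ k, F (k + 1) n = F (k + 1) (n - 1) + F k n) :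
    ∀ (k₀ K' : ℕ), stepAcc (stList (fun k => F k (n - 1)) k₀ K') (F k₀ n) = stList (fun k => F k n) k₀ K'
  | _, 0 => rfl
  | k₀, K' + 1 => by
    simp only [stList, stepAcc]
    rw [← hF k₀, stepAcc_stList F n hF (k₀ + 1) K']

/-! ### The block step, the block test, the walk, the certificate -/

/-- **One block, all orders.** From the state `[S_{k₀+1}, …, S_K]` at the position before the block and the packed
plus/minus parts `Up, Um` of the values `S_{k₀}` over the block (`L` digits, digit bound `D`): for each order,
`U' = S⁺·R + (U·R mod 2^{bL})` (`R = onesV b L`: prefix sums), the outgoing state entry is the last digit of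
`U'⁺ − U'⁻`, the digit bound becomes `|S| + L·D`; returns the new state, the top-order vectors and their bound.
[cite: MontgomeryVaughan2007, §11.2.1 Exercise 7 (f)] -/
def levels (b L R Kmask : ℕ) : List ℤ → ℕ → ℕ → ℕ → List ℤ × ℕ × ℕ × ℕ
  | [], Up, Um, D => ([], Up, Um, D)
  | s :: rest, Up, Um, D =>
    let Up' := s.toNat * R + ((Up * R) &&& Kmask)
    let Um' := (-s).toNat * R + ((Um * R) &&& Kmask)
    match levels b L R Kmask rest Up' Um' (s.natAbs + L * D) with
    | (st, UpK, UmK, DK) => ((((dig b Up' (L - 1) : ℕ) : ℤ) - ((dig b Um' (L - 1) : ℕ) : ℤ)) :: st, UpK, UmK, DK)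

/-- **The block test**: the digit bound is below the half digit `H = 2^{b−1}`, and `U⁺ + H·𝟙 − U⁻` has every top
bit set (i.e. `S_K ≥ 0` at every position of the block). [cite: MontgomeryVaughan2007, §11.2.1 Exercise 7 (f)] -/
def blockOK (b L UpK UmK DK : ℕ) : Bool :=
  let HR := 2 ^ (b - 1) * onesV b L
  Nat.blt DK (2 ^ (b - 1)) && Nat.beq ((UpK + HR - UmK) &&& HR) HR

/-- **The walk** over a segment of `len` slots whose packed plus/minus tables are `Tp, Tm` (lowest digit =
first slot), by BINARY SPLITTING of depth `e` (so that the leaves are blocks of `≈ len/2^e` slots and the total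
size of the intermediate numerals is `O(len·b·e)`): a leaf runs `levels` + `blockOK` on its block, a node walks
the lower half then the upper half; `none` as soon as a block fails, else the state after the segment.
[cite: MontgomeryVaughan2007, §11.2.1 Exercise 7 (f)] -/
def walk (b : ℕ) : ℕ → ℕ → ℕ → ℕ → List ℤ → Option (List ℤ)
  | 0, len, Tp, Tm, st =>
    bif Nat.beq len 0 then some st else
    match levels b len (onesV b len) ((1 <<< (b * len)) - 1) st Tp Tm 1 with
    | (st', UpK, UmK, DK) => bif blockOK b len UpK UmK DK then some st' else none
  | e + 1, len, Tp, Tm, st =>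
    match walk b e (len / 2) (Tp &&& ((1 <<< (b * (len / 2))) - 1)) (Tm &&& ((1 <<< (b * (len / 2))) - 1)) st with
    | none => none
    | some st' => walk b e (len - len / 2) (Tp >>> (b * (len / 2))) (Tm >>> (b * (len / 2))) st'

/-- **The certificate of order `K`** over `Q` slots from the sign tables `T` (splitting depth `e`): the walk
passes from the zero state and the final sums `S_1(Q), …, S_K(Q)` (one more step with the value `0` at `n = Q`)
are `≥ 0`. [cite: MontgomeryVaughan2007, §11.2.1 Exercise 7 (f)] -/
def blockCert (b e K Q : ℕ) (T : ℕ × ℕ) : Bool :=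
  match walk b e Q T.1 T.2 (List.replicate K 0) with
  | none => false
  | some st => (stepAcc st 0).all fun s => decide (0 ≤ s)

/-- Sanity checks (kernel `decide`) on the Jacobi tables of `FeketePolyaKernelSignTables.lean`: `d = 53` passes
at order `3` along `53` (`b = 32`, splitting depth `2`: blocks of `13–14`), `d = −67` fails at order `12`. [folklore] -/
example : blockCert 32 2 3 53 (jacTabs 32 53 [53]) = true ∧ blockCert 40 2 12 67 (jacTabs 40 67 [67]) = false := by
  decide +kernel

/-! ### Soundness of the block step -/

/-- Unfolding one order of `levels`. [folklore] -/
private theorem levels_cons (b L R Kmask : ℕ) (s : ℤ) (rest : List ℤ) (Up Um D : ℕ) :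
    levels b L R Kmask (s :: rest) Up Um D =
      ((((dig b (s.toNat * R + ((Up * R) &&& Kmask)) (L - 1) : ℕ) : ℤ) -
          ((dig b ((-s).toNat * R + ((Um * R) &&& Kmask)) (L - 1) : ℕ) : ℤ)) ::
        (levels b L R Kmask rest (s.toNat * R + ((Up * R) &&& Kmask)) ((-s).toNat * R + ((Um * R) &&& Kmask))
          (s.natAbs + L * D)).1,
      (levels b L R Kmask rest (s.toNat * R + ((Up * R) &&& Kmask)) ((-s).toNat * R + ((Um * R) &&& Kmask))
          (s.natAbs + L * D)).2) := by
  rcases hres : levels b L R Kmask rest (s.toNat * R + ((Up * R) &&& Kmask))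
    ((-s).toNat * R + ((Um * R) &&& Kmask)) (s.natAbs + L * D) with ⟨st, UpK, UmK, DK⟩
  simp only [levels, hres]

/-- The digit bound only grows along `levels` (`L ≥ 1`). [folklore] -/
private theorem le_levels_D {b L R Kmask : ℕ} (hL : 1 ≤ L) :
    ∀ (st : List ℤ) (Up Um D : ℕ), D ≤ (levels b L R Kmask st Up Um D).2.2.2
  | [], _, _, _ => le_rfl
  | s :: rest, Up, Um, D => by
    rw [levels_cons]
    exact le_trans ((Nat.le_mul_of_pos_left D hL).trans (Nat.le_add_left _ _)) (le_levels_D hL rest _ _ _)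

/-- **Invariant of `levels`.** If `Up, Um` pack digit functions `up, um ≤ D` over `L` slots with
`up − um = S_{k₀}` over the block, the state is `[S_k(pos − 1)]_{k₀ < k ≤ k₀ + K'}`, and the final digit bound is
`< 2^{b−1}`, then the returned state is `[S_k(pos + L − 1)]_k` and the returned vectors pack digit functions
`f, g ≤ D_K` with `f − g = S_{k₀ + K'}` over the block. [cite: MontgomeryVaughan2007, §11.2.1 Exercise 7 (f)] -/
theorem levels_spec {b L : ℕ} (hb : 2 ≤ b) (hL : 1 ≤ L) {x : ℕ → ℤ} (hx0 : x 0 = 0) (pos : ℕ) :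
    ∀ (K' k₀ : ℕ) (Up Um D : ℕ) (up um : ℕ → ℕ),
    Up = kpack b L up → Um = kpack b L um → (∀ j < L, up j ≤ D) → (∀ j < L, um j ≤ D) →
    (∀ j < L, (up j : ℤ) - um j = itS x k₀ (pos + j)) →
    (levels b L (onesV b L) (2 ^ (b * L) - 1) (stList (fun k => itS x k (pos - 1)) k₀ K') Up Um D).2.2.2
      < 2 ^ (b - 1) →
    (levels b L (onesV b L) (2 ^ (b * L) - 1) (stList (fun k => itS x k (pos - 1)) k₀ K') Up Um D).1 =
      stList (fun k => itS x k (pos + L - 1)) k₀ K' ∧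
    ∃ f g : ℕ → ℕ,
      (levels b L (onesV b L) (2 ^ (b * L) - 1) (stList (fun k => itS x k (pos - 1)) k₀ K') Up Um D).2.1 =
        kpack b L f ∧
      (levels b L (onesV b L) (2 ^ (b * L) - 1) (stList (fun k => itS x k (pos - 1)) k₀ K') Up Um D).2.2.1 =
        kpack b L g ∧
      (∀ j < L, f j ≤ (levels b L (onesV b L) (2 ^ (b * L) - 1)
        (stList (fun k => itS x k (pos - 1)) k₀ K') Up Um D).2.2.2) ∧
      (∀ j < L, g j ≤ (levels b L (onesV b L) (2 ^ (b * L) - 1)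
        (stList (fun k => itS x k (pos - 1)) k₀ K') Up Um D).2.2.2) ∧
      (∀ j < L, (f j : ℤ) - g j = itS x (k₀ + K') (pos + j))
  | 0, k₀, Up, Um, D, up, um, hUp, hUm, hupD, humD, hdiff, _ => by
    refine ⟨rfl, up, um, hUp, hUm, hupD, humD, by simpa using hdiff⟩
  | K' + 1, k₀, Up, Um, D, up, um, hUp, hUm, hupD, humD, hdiff, hDK => by
    have hb1 : 1 ≤ b := by omega
    -- names
    set s : ℤ := itS x (k₀ + 1) (pos - 1) with hs
    set R := onesV b L with hR
    set Kmask := 2 ^ (b * L) - 1 with hKmask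
    set Up' := s.toNat * R + ((Up * R) &&& Kmask) with hUp'
    set Um' := (-s).toNat * R + ((Um * R) &&& Kmask) with hUm'
    set D' := s.natAbs + L * D with hD'
    have hlev : levels b L R Kmask (stList (fun k => itS x k (pos - 1)) k₀ (K' + 1)) Up Um D =
        ((((dig b Up' (L - 1) : ℕ) : ℤ) - ((dig b Um' (L - 1) : ℕ) : ℤ)) ::
          (levels b L R Kmask (stList (fun k => itS x k (pos - 1)) (k₀ + 1) K') Up' Um' D').1,
         (levels b L R Kmask (stList (fun k => itS x k (pos - 1)) (k₀ + 1) K') Up' Um' D').2) := by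
      rw [stList, levels_cons]
    rw [hlev] at hDK ⊢
    simp only at hDK ⊢
    -- the digit bound available: D' ≤ DK < 2^(b-1) < 2^b
    have hD'le : D' ≤ (levels b L R Kmask (stList (fun k => itS x k (pos - 1)) (k₀ + 1) K') Up' Um' D').2.2.2 :=
      le_levels_D hL _ _ _ _
    have hD'lt : D' < 2 ^ (b - 1) := lt_of_le_of_lt hD'le hDK
    have hHb : 2 ^ (b - 1) < 2 ^ b := Nat.pow_lt_pow_right (by norm_num) (by omega)
    have hLD : L * D ≤ D' := Nat.le_add_left _ _
    -- the new digit functions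
    set up' : ℕ → ℕ := fun j => s.toNat + psumF up j with hup'
    set um' : ℕ → ℕ := fun j => (-s).toNat + psumF um j with hum'
    have hsum_up : ∑ i ∈ range L, up i < 2 ^ b := by
      refine lt_of_le_of_lt ?_ (lt_of_le_of_lt hLD (hD'lt.trans hHb))
      calc ∑ i ∈ range L, up i ≤ ∑ _i ∈ range L, D := Finset.sum_le_sum fun i hi => hupD i (mem_range.1 hi)
        _ = L * D := by rw [sum_const, card_range, smul_eq_mul]
    have hsum_um : ∑ i ∈ range L, um i < 2 ^ b := by
      refine lt_of_le_of_lt ?_ (lt_of_le_of_lt hLD (hD'lt.trans hHb))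
      calc ∑ i ∈ range L, um i ≤ ∑ _i ∈ range L, D := Finset.sum_le_sum fun i hi => humD i (mem_range.1 hi)
        _ = L * D := by rw [sum_const, card_range, smul_eq_mul]
    have hUp'k : Up' = kpack b L up' := by
      rw [hUp', hUp, hKmask, kpack_mul_onesV_low hb1 hsum_up, hR, onesV_eq_kpack hb1, kpack_smul, kpack_add_kpack]
      exact kpack_congr fun j _ => by rw [mul_one]
    have hUm'k : Um' = kpack b L um' := by
      rw [hUm', hUm, hKmask, kpack_mul_onesV_low hb1 hsum_um, hR, onesV_eq_kpack hb1, kpack_smul, kpack_add_kpack]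
      exact kpack_congr fun j _ => by rw [mul_one]
    have hup'D : ∀ j < L, up' j ≤ D' := fun j hj => by
      have := psumF_le_mul up hj hupD
      simp only [hup', hD']
      omega
    have hum'D : ∀ j < L, um' j ≤ D' := fun j hj => by
      have := psumF_le_mul um hj humD
      simp only [hum', hD']
      omega
    have hdiff' : ∀ j < L, (up' j : ℤ) - um' j = itS x (k₀ + 1) (pos + j) := fun j hj => by
      simp only [hup', hum', psumF]
      push_cast
      rw [itS_block hx0 k₀ pos j, ← hs,
        ← Finset.sum_congr rfl fun i hi => hdiff i (lt_of_lt_of_le (mem_range.1 hi) (by omega)),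
        Finset.sum_sub_distrib]
      have := Int.toNat_sub_toNat_neg s
      linarith
    -- induction hypothesis for the remaining orders
    obtain ⟨ih1, f, g, hf, hg, hfD, hgD, hfg⟩ := levels_spec hb hL hx0 pos K' (k₀ + 1) Up' Um' D' up' um'
      hUp'k hUm'k hup'D hum'D hdiff' hDK
    refine ⟨?_, f, g, hf, hg, hfD, hgD, fun j hj => by rw [hfg j hj]; ring_nf⟩
    rw [stList, ih1]
    congr 1
    have hdig : ∀ {U : ℕ} {u : ℕ → ℕ}, U = kpack b L u → (∀ j < L, u j ≤ D') → dig b U (L - 1) = u (L - 1) :=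
      fun hU hu => by
        rw [hU, dig_kpack (fun j hj => lt_of_le_of_lt (hu j hj) (hD'lt.trans hHb)), if_pos (by omega)]
    rw [hdig hUp'k hup'D, hdig hUm'k hum'D, hdiff' (L - 1) (by omega),
      show pos + (L - 1) = pos + L - 1 by omega]

/-- **The block test, part 1**: the digit bound is below the half digit. [cite: MontgomeryVaughan2007, §11.2.1 Exercise 7 (f)] -/
theorem blockOK_lt {b L UpK UmK DK : ℕ} (h : blockOK b L UpK UmK DK = true) : DK < 2 ^ (b - 1) := by
  unfold blockOK at h
  simp only [Bool.and_eq_true, Nat.blt_eq] at h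
  exact h.1

/-- **The block test, part 2**: if it passes, the minus digits are dominated by the plus digits — i.e.
`S_K ≥ 0` at every position of the block. [cite: MontgomeryVaughan2007, §11.2.1 Exercise 7 (f)] -/
theorem blockOK_le {b L UpK UmK DK : ℕ} (hb : 2 ≤ b) {f g : ℕ → ℕ} (hf : UpK = kpack b L f)
    (hg : UmK = kpack b L g) (hfD : ∀ j < L, f j ≤ DK) (hgD : ∀ j < L, g j ≤ DK)
    (h : blockOK b L UpK UmK DK = true) : ∀ j < L, g j ≤ f j := by
  have hb1 : 1 ≤ b := by omega
  have hDK := blockOK_lt h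
  unfold blockOK at h
  simp only [Bool.and_eq_true, Nat.beq_eq] at h
  obtain ⟨-, h⟩ := h
  set H := 2 ^ (b - 1) with hH
  have hHb : H + H = 2 ^ b := by
    rw [hH, ← two_mul, ← pow_succ']; congr 1; omega
  have hHR : H * onesV b L = kpack b L fun _ => H := by
    rw [onesV_eq_kpack hb1, kpack_smul]; simp only [mul_one]
  have hW : UpK + H * onesV b L - UmK = kpack b L fun j => f j + (H - g j) := by
    rw [hHR, hf, hg, Nat.add_sub_assoc (by
        rw [show (kpack b L fun _ => H) = kpack b L g + kpack b L (fun j => H - g j) from by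
          rw [kpack_add_kpack]; exact kpack_congr fun j hj => by have := hgD j hj; omega]
        exact Nat.le_add_right _ _),
      kpack_tsub fun j hj => by have := hgD j hj; omega, kpack_add_kpack]
  rw [hW, hHR] at h
  intro j hj
  have hfj : f j < H := lt_of_le_of_lt (hfD j hj) hDK
  have hdig : ∀ j' < L, (fun j => f j + (H - g j)) j' < 2 ^ b := fun j' hj' => by
    have := hfD j' hj'; have := hgD j' hj'; simp only; omega
  have hHd : ∀ j' < L, (fun _ : ℕ => H) j' < 2 ^ b := fun _ _ => by simp only; omega
  -- bit `b j + (b - 1)` of both sides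
  have hbit := congrArg (fun N => N.testBit (b * j + (b - 1))) h
  simp only [Nat.testBit_and, testBit_kpack (by omega) hdig, testBit_kpack (by omega) hHd] at hbit
  have hdiv : (b * j + (b - 1)) / b = j := by
    rw [Nat.add_comm, Nat.add_mul_div_left _ _ (by omega), Nat.div_eq_of_lt (by omega), zero_add]
  have hmod : (b * j + (b - 1)) % b = b - 1 := by
    rw [Nat.add_comm, Nat.add_mul_mod_self_left, Nat.mod_eq_of_lt (by omega)]
  rw [hdiv, hmod, if_pos hj, if_pos hj, hH, Nat.testBit_two_pow_self, Bool.and_true] at hbit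
  have := Nat.ge_two_pow_of_testBit hbit
  omega

/-! ### Soundness of the walk and of the certificate -/

/-- **Invariant of the walk**: on the packed tables of the slots `pos, …, pos + len − 1` and the state
`[S_k(pos − 1)]_k`, a successful walk returns `[S_k(pos + len − 1)]_{1 ≤ k ≤ K}` and certifies `S_K(n) ≥ 0` for
`pos ≤ n < pos + len`. [cite: MontgomeryVaughan2007, §11.2.1 Exercise 7 (f)] -/
theorem walk_spec {b K : ℕ} (hb : 2 ≤ b) {x : ℕ → ℤ} (hx0 : x 0 = 0) {dp dm : ℕ → ℕ}
    (hdp : ∀ n, dp n ≤ 1) (hdm : ∀ n, dm n ≤ 1) (hx : ∀ n, (dp n : ℤ) - dm n = x n) :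
    ∀ (e len pos : ℕ) (st : List ℤ),
    walk b e len (kpack b len fun i => dp (pos + i)) (kpack b len fun i => dm (pos + i))
      (stList (fun k => itS x k (pos - 1)) 0 K) = some st →
    st = stList (fun k => itS x k (pos + len - 1)) 0 K ∧ ∀ n, pos ≤ n → n < pos + len → 0 ≤ itS x K n := by
  have hb1 : 1 ≤ b := by omega
  have h1b : (1 : ℕ) < 2 ^ b := Nat.one_lt_two_pow (by omega)
  intro e
  induction e with
  | zero =>
    intro len pos st h
    rw [walk] at h
    simp only [Nat.one_shiftLeft] at h
    by_cases hlen : len = 0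
    · subst hlen
      simp only [show Nat.beq 0 0 = true from rfl, cond_true, Option.some.injEq] at h
      exact ⟨by rw [← h, Nat.add_zero], fun n hn hn' => by omega⟩
    have hbeq : Nat.beq len 0 = false := by
      cases hq : Nat.beq len 0
      · rfl
      · exact absurd (Nat.eq_of_beq_eq_true hq) hlen
    simp only [hbeq, cond_false] at h
    have hL1 : 1 ≤ len := Nat.one_le_iff_ne_zero.mpr hlen
    rcases hres : levels b len (onesV b len) (2 ^ (b * len) - 1) (stList (fun k => itS x k (pos - 1)) 0 K)
        (kpack b len fun i => dp (pos + i)) (kpack b len fun i => dm (pos + i)) 1 with ⟨st', UpK, UmK, DK⟩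
    rw [hres] at h
    simp only at h
    cases hok : blockOK b len UpK UmK DK
    · simp [hok] at h
    simp only [hok, cond_true, Option.some.injEq] at h
    have hDK : DK < 2 ^ (b - 1) := blockOK_lt hok
    have hspec := levels_spec hb hL1 hx0 pos K 0 (kpack b len fun i => dp (pos + i))
      (kpack b len fun i => dm (pos + i)) 1 (fun i => dp (pos + i)) (fun i => dm (pos + i)) rfl rfl
      (fun j _ => hdp _) (fun j _ => hdm _) (fun j _ => by rw [hx]; rfl)
    rw [hres] at hspec
    obtain ⟨hst', f, g, hf, hg, hfD, hgD, hfg⟩ := hspec hDK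
    simp only at hst' hf hg hfD hgD
    simp only [zero_add] at hfg
    have hle := blockOK_le hb hf hg hfD hgD hok
    refine ⟨by rw [← h, hst'], fun n hn hn' => ?_⟩
    obtain ⟨j, rfl⟩ : ∃ j, n = pos + j := ⟨n - pos, by omega⟩
    have hj : j < len := by omega
    have := hfg j hj
    have := hle j hj
    omega
  | succ e ih =>
    intro len pos st h
    rw [walk] at h
    simp only [Nat.one_shiftLeft] at h
    have hle : len / 2 ≤ len := Nat.div_le_self len 2
    obtain ⟨r, hr⟩ : ∃ r, len = len / 2 + r := ⟨len - len / 2, by omega⟩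
    have hlowp : (kpack b len fun i => dp (pos + i)) &&& (2 ^ (b * (len / 2)) - 1) =
        kpack b (len / 2) fun i => dp (pos + i) :=
      kpack_land_low hle fun j _ => lt_of_le_of_lt (hdp _) h1b
    have hlowm : (kpack b len fun i => dm (pos + i)) &&& (2 ^ (b * (len / 2)) - 1) =
        kpack b (len / 2) fun i => dm (pos + i) :=
      kpack_land_low hle fun j _ => lt_of_le_of_lt (hdm _) h1b
    have hhighp : (kpack b len fun i => dp (pos + i)) >>> (b * (len / 2)) =
        kpack b (len - len / 2) fun i => dp (pos + len / 2 + i) := by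
      rw [show (kpack b len fun i => dp (pos + i)) = kpack b (len / 2 + r) fun i => dp (pos + i) from by rw [← hr],
        kpack_shiftRight_high fun j _ => lt_of_le_of_lt (hdp _) h1b, show len - len / 2 = r by omega]
      exact kpack_congr fun i _ => by rw [add_assoc]
    have hhighm : (kpack b len fun i => dm (pos + i)) >>> (b * (len / 2)) =
        kpack b (len - len / 2) fun i => dm (pos + len / 2 + i) := by
      rw [show (kpack b len fun i => dm (pos + i)) = kpack b (len / 2 + r) fun i => dm (pos + i) from by rw [← hr],
        kpack_shiftRight_high fun j _ => lt_of_le_of_lt (hdm _) h1b, show len - len / 2 = r by omega]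
      exact kpack_congr fun i _ => by rw [add_assoc]
    rw [hlowp, hlowm, hhighp, hhighm] at h
    rcases hlow : walk b e (len / 2) (kpack b (len / 2) fun i => dp (pos + i)) (kpack b (len / 2) fun i => dm (pos + i))
        (stList (fun k => itS x k (pos - 1)) 0 K) with _ | st₁
    · rw [hlow] at h; simp at h
    rw [hlow] at h
    simp only at h
    obtain ⟨hst₁, hpos₁⟩ := ih (len / 2) pos st₁ hlow
    rw [hst₁, show pos + len / 2 - 1 = (pos + len / 2) - 1 by omega] at h
    obtain ⟨hst, hpos₂⟩ := ih (len - len / 2) (pos + len / 2) st h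
    refine ⟨by rw [hst, show pos + len / 2 + (len - len / 2) - 1 = pos + len - 1 by omega], fun n hn hn' => ?_⟩
    by_cases hnl : n < pos + len / 2
    · exact hpos₁ n hn hnl
    · exact hpos₂ n (by omega) (by omega)

/-- **Soundness of the block certificate** (abstract value stream). If `x : ℕ → ℤ` takes values in
`{0, ±1}`, `x 0 = x Q = 0`, `T` are its sign tables over `Q ≥ 1` slots, `b ≥ 2`, `K ≥ 1` and
`blockCert b e K Q T` (any splitting depth `e`), then `S_K(n) ≥ 0` for all `n ≤ Q` and `S_j(Q) ≥ 0` for `1 ≤ j ≤ K`.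
[cite: MontgomeryVaughan2007, §11.2.1 Exercise 7 (f)] -/
theorem blockCert_sound {b e K Q : ℕ} (hb : 2 ≤ b) (hK : 1 ≤ K) (hQ : 1 ≤ Q) {x : ℕ → ℤ}
    (hx0 : x 0 = 0) (hxQ : x Q = 0) (hx3 : ∀ n, Val3 (x n)) {T : ℕ × ℕ} (hT : IsSignTab b Q x T)
    (h : blockCert b e K Q T = true) :
    (∀ n, n ≤ Q → 0 ≤ itS x K n) ∧ (∀ j, 1 ≤ j → j ≤ K → 0 ≤ itS x j Q) := by
  obtain ⟨Tp, Tm⟩ := T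
  obtain ⟨hTp, hTm⟩ := hT
  simp only at hTp hTm
  set dp : ℕ → ℕ := fun n => ind (x n = 1) with hdp
  set dm : ℕ → ℕ := fun n => ind (x n = -1) with hdm
  have hdp1 : ∀ n, dp n ≤ 1 := fun n => ind_le_one _
  have hdm1 : ∀ n, dm n ≤ 1 := fun n => ind_le_one _
  have hx : ∀ n, (dp n : ℤ) - dm n = x n := fun n => by
    rcases hx3 n with h | h | h <;> simp [hdp, hdm, ind, h]
  unfold blockCert at h
  simp only at h
  have hinit : List.replicate K 0 = stList (fun k => itS x k (0 - 1)) 0 K :=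
    (stList_const 0 K fun k hk _ => by
      obtain ⟨k', rfl⟩ : ∃ k', k = k' + 1 := ⟨k - 1, by omega⟩
      exact itS_succ_zero x k').symm
  have hTp' : Tp = kpack b Q fun i => dp (0 + i) := by
    rw [hTp]; exact kpack_congr fun i _ => by rw [zero_add]
  have hTm' : Tm = kpack b Q fun i => dm (0 + i) := by
    rw [hTm]; exact kpack_congr fun i _ => by rw [zero_add]
  rw [hinit, hTp', hTm'] at h
  rcases hw : walk b e Q (kpack b Q fun i => dp (0 + i)) (kpack b Q fun i => dm (0 + i))
      (stList (fun k => itS x k (0 - 1)) 0 K) with _ | st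
  · rw [hw] at h; simp at h
  rw [hw] at h
  simp only [List.all_eq_true, decide_eq_true_eq] at h
  obtain ⟨hst, hpos⟩ := walk_spec hb hx0 hdp1 hdm1 hx e Q 0 st hw
  rw [zero_add] at hst
  -- the final sums `S_j(Q)`
  have hstep : stepAcc st 0 = stList (fun k => itS x k Q) 0 K := by
    rw [hst, show (0 : ℤ) = itS x 0 Q from hxQ.symm]
    exact stepAcc_stList (itS x) Q (fun k => by
      obtain ⟨Q', rfl⟩ : ∃ Q', Q = Q' + 1 := ⟨Q - 1, by omega⟩
      rw [Nat.add_sub_cancel]; exact itS_succ_succ x k Q') 0 K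
  rw [hstep] at h
  have hfin : ∀ j, 1 ≤ j → j ≤ K → 0 ≤ itS x j Q := fun j hj hjK =>
    h _ (mem_stList (fun k => itS x k Q) 0 K j hj (by omega))
  refine ⟨fun n hn => ?_, hfin⟩
  rcases Nat.lt_or_eq_of_le hn with hlt | rfl
  · exact hpos n (Nat.zero_le _) (by omega)
  · exact hfin K hK le_rfl

/-! ### The engine -/

/-- `itS` of the values of a table is `FeketePolyaTable.ipsum`. [cite: MontgomeryVaughan2007, §11.2.1 Exercise 7 (c)] -/
theorem itS_eq_ipsum {x : ℕ → ℤ} {l : List ℤ} (hl : ∀ n, tableVal l n = x n) :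
    ∀ k n, itS x k n = ipsum l k n
  | 0, n => (hl n).symm
  | k + 1, n => by
    show ∑ m ∈ Icc 1 n, itS x k m = ∑ m ∈ Icc 1 n, ipsum l k m
    exact Finset.sum_congr rfl fun m _ => itS_eq_ipsum hl k m

/-- `ipsum` cast to `ℝ` is the tree's `iterSummatory`. [cite: MontgomeryVaughan2007, §11.2.1 Exercise 7 (c)] -/
theorem ipsum_cast_real (l : List ℤ) : ∀ k N, (ipsum l k N : ℝ) = iterSummatory (fun n ↦ ((tableVal l n : ℤ) : ℝ)) k N
  | 0, N => by simp [ipsum]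
  | k + 1, N => by
    rw [show ipsum l (k + 1) N = ∑ n ∈ Icc 1 N, ipsum l k n from rfl, iterSummatory_succ, summatory]
    push_cast
    exact Finset.sum_congr rfl fun n _ ↦ ipsum_cast_real l k n

/-- A `Q`-periodic function is determined by its values on `n mod Q`. [folklore] -/
private theorem periodic_mod {f : ℕ → ℤ} {Q : ℕ} (hf : ∀ n, f (n + Q) = f n) (n : ℕ) : f (n % Q) = f n := by
  have key : ∀ k r, f (r + Q * k) = f r := fun k => by
    induction k with
    | zero => intro r; simp
    | succ k ih => intro r; rw [Nat.mul_succ, ← add_assoc, hf, ih]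
  conv_rhs => rw [← Nat.mod_add_div n Q]
  exact (key _ _).symm

/-- **The engine (v4).** `χ ≠ χ₀` quadratic mod `q`, `ℜχ(n) = v(n)`, `w ≥ 1`, sign tables `T` of the induced
values `indVal v (q·w)` and a passing `blockCert b e K (q·w) T` (`K ≥ 1`, `b ≥ 2`): then
`L(σ, χ) ≠ 0` for every `σ > 0` — Fekete–Pólya at order `K` for `χ↑(q·w)` (`FeketePolya1912_holds`; one
period suffices, `FeketePolyaTable.ipsum_nonneg_of_period`), and the descent
`L(σ, χ↑(q·w)) = L(σ, χ)·∏_{p ∣ q·w}(1 − χ(p)p^{−σ})` with positive Euler factors.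
[cite: MontgomeryVaughan2007, §11.2.1 Exercises 7 (g), 8] [cite: FeketePolya1912] -/
theorem lfunction_ne_zero_of_blockCert {q : ℕ} [NeZero q] (χ : DirichletCharacter ℂ q) (hχ : χ ≠ 1)
    (hquad : χ.IsQuadratic) (v : ℕ → ℤ) (hv : ∀ n : ℕ, (χ (n : ZMod q)).re = v n) {w K b e : ℕ}
    (hw : w ≠ 0) (hK : 1 ≤ K) (hb : 2 ≤ b) {T : ℕ × ℕ}
    (hT : IsSignTab b (q * w) (indVal v (q * w)) T) (h : blockCert b e K (q * w) T = true) {σ : ℝ}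
    (hσ : 0 < σ) : χ.LFunction (σ : ℂ) ≠ 0 := by
  have hq0 : q ≠ 0 := NeZero.ne q
  have hq1 : q ≠ 1 := fun h1 => hχ (DirichletCharacter.level_one' χ h1)
  set Q := q * w with hQ
  haveI : NeZero Q := ⟨Nat.mul_ne_zero hq0 hw⟩
  have hQ2 : 2 ≤ Q := by
    have : 1 ≤ w := Nat.one_le_iff_ne_zero.mpr hw
    have : 2 ≤ q := by omega
    calc 2 ≤ q := this
      _ = q * 1 := (mul_one q).symm
      _ ≤ q * w := Nat.mul_le_mul_left q ‹1 ≤ w›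
  have hqQ : q ∣ Q := dvd_mul_right q w
  set x : ℕ → ℤ := indVal v Q with hx
  have hx0 : x 0 = 0 := by
    simp only [hx, indVal, Nat.gcd_zero_left]; rw [if_neg]; omega
  have hxQ : x Q = 0 := by
    simp only [hx, indVal, Nat.gcd_self]; rw [if_neg]; omega
  have hv3 : ∀ n, v n = 0 ∨ v n = 1 ∨ v n = -1 := fun n ↦ by
    rcases hquad (n : ZMod q) with h0 | h1 | h2
    · left; exact_mod_cast (by rw [← hv, h0, Complex.zero_re] : (v n : ℝ) = 0)
    · right; left; exact_mod_cast (by rw [← hv, h1, Complex.one_re] : (v n : ℝ) = 1)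
    · right; right
      exact_mod_cast (by rw [← hv, h2, Complex.neg_re, Complex.one_re] : (v n : ℝ) = -1)
  have hx3 : ∀ n, Val3 (x n) := fun n => by
    simp only [hx, indVal, Val3]
    split_ifs
    · exact hv3 n
    · exact Or.inl rfl
  obtain ⟨hA, hB'⟩ := blockCert_sound hb hK (by omega) hx0 hxQ hx3 hT h
  -- the specification table over one period
  set l : List ℤ := (List.range Q).map x with hl
  have hlen : l.length = Q := by simp [hl]
  have hper : ∀ n, x (n + Q) = x n := fun n => indVal_add_level hqQ χ v hv n
  have htab : ∀ n, tableVal l n = x n := fun n => by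
    rw [tableVal, hlen, hl, List.getD_eq_getElem?_getD, List.getElem?_map,
      List.getElem?_range (Nat.mod_lt n (by omega))]
    exact periodic_mod hper n
  have hips : ∀ k n, itS x k n = ipsum l k n := itS_eq_ipsum htab
  have hnonneg : ∀ N, 1 ≤ N → 0 ≤ ipsum l K N :=
    ipsum_nonneg_of_period l (by omega) (fun j hj hjK => by rw [hlen, ← hips]; exact hB' j hj hjK)
      fun N _ hNQ => by rw [← hips]; exact hA N (by omega)
  -- Fekete–Pólya for the induced character, then descent
  set ψ := DirichletCharacter.changeLevel hqQ χ with hψ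
  have hψ1 : ψ ≠ 1 := fun h' ↦ hχ ((DirichletCharacter.changeLevel_eq_one_iff hqQ).mp h')
  have hsq : χ ^ 2 = 1 := MulChar.isQuadratic_iff_sq_eq_one.mp hquad
  have hψsq : ψ ^ 2 = 1 := by rw [hψ, ← map_pow, hsq, map_one]
  have hψquad : ψ.IsQuadratic := MulChar.isQuadratic_iff_sq_eq_one.mpr hψsq
  have hf : (fun n : ℕ ↦ (ψ (n : ZMod Q)).re) = fun n ↦ ((tableVal l n : ℤ) : ℝ) := by
    funext n
    rw [htab, hψ, re_changeLevel_eq_indVal hqQ χ v hv n]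
  have hψpos : 0 < (ψ.LFunction (σ : ℂ)).re := by
    refine FeketePolya1912_holds Q ψ hψ1 hψquad K hK (fun N hN ↦ ?_) σ hσ
    rw [hf, ← ipsum_cast_real]
    exact_mod_cast hnonneg N hN
  rw [hψ, re_LFunction_changeLevel_ofReal hqQ χ hχ hsq σ] at hψpos
  have hpos := pos_of_mul_pos_left hψpos (eulerFactors_pos Q χ hsq hσ).le
  intro h0
  rw [h0, Complex.zero_re] at hpos
  exact lt_irrefl _ hpos

end FeketePolyaKernel

end Literature.NumberTheory.LFunctions
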